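/-
Copyright (c) 2026 the pub-hodgecm-mathlib formalisation cell (harness21).  Prover seat hodgecm-mathlib-K2E3-p20 (g5), Track B «K2-LIT» ∕ h413
(`stmt-HodgeConjecture-24833`), line `K2_E3_EllipticInputs`, unit U12 §L, kernel road «RICHARDSON» for (L-B_GL) at `N = 3` (road owner K2E3-p11 (g4)),
brick (R2-Borel) part 2 ∕ (R1) CLOSED: `Λ_J` IS CARRIED BY `Ad·J`, `Λ_J ≠ 0`, AND `J(𝒩)(𝔤𝔩₃(F)) = ℂδ₀ ⊕ ℂΛ_E ⊕ ℂΛ_J` WITH BOTH MEASURES EXPLICIT.  2026-09-04.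
-/
import Summits.HodgeConjecture.HodgeConjecture.Theorems.K2E3GL3BorelRichardsonMeasure     -- (R2-Borel) Lie side part 1 (this seat): `Λ_J` dictionary, `Ad`-invariance, Radon, §1 null lemma
import Summits.HodgeConjecture.HodgeConjecture.Theorems.K2E3GL3MinimalRichardsonMeasure    -- ★ p857400 (K2E3-p21 g4): `Λ_E` package + (R1d) with `Λ_E` discharged; brings ★ (R1d) p857363, ★ R1a∕R1b
import HarnessLib

/-!
# K2_E3 road (h413), §L — kernel road «RICHARDSON» for (L-B_GL) at `N = 3`: `Λ_J` is carried by the regular orbit and non-zero, and the STRUCTURE of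
# `J(𝒩)(𝔤𝔩₃(F))` — every invariant distribution supported on the nilpotent cone is `a·δ₀ + b·Λ_E + c·Λ_J`, both Richardson measures explicit

Cell `pub/hodgecm-mathlib` (D-0151), Track B, seat K2E3-p20 (g5); road owner K2E3-p11 (g4), §L lead K2E3-p12 (g4), dealer K2E3-plan (g3).
`--supports stmt-HodgeConjecture-24833 --as helper`; THEOREMS ONLY (no definition ∕ instance ∕ notation ∕ named fact ∕ `sorry`); never imports `Cruxes/…/Lines`.
COUNT-NEUTRAL ((L-B_GL) ∕ (LBGL-ge3) `sig_K2E3GLnNilpotentFourierRegularGeThree` stay OPEN: the REGULARITY half (b) — `μ̂_E`, `μ̂_J` are locally integrable functions,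
locally constant on the regular set, `|D|^{1∕2}`-bounded — is not here).

`G = GL₃(F)`, `K = GL₃(𝒪)`, `N₃` upper unitriangular, `U` the unipotent radical of the `(2,1)` parabolic, Haar measures `κ`, `μ_N`, `μ_U`;
`Λ_J = (Ad(k)(u − 1))_*(κ ⊗ μ_N)` (part 1: `Ad`-invariant, Radon), `Λ_E = (Ad(k)(u − 1))_*(κ ⊗ μ_U)` (★ p857384∕p857400, K2E3-p21 (g4)).
* §3 `haar_unipotentRadicalGL_setOf_apply_eq_zero` — `{u ∈ N₃ | u_{ij} = 0}` (`i < j`) is `μ_N`-NULL: its left translates by the transvections `T_{ij}(a^m)` (`0 < ‖a‖ < 1`,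
  `a ∈ 𝒪`, all inside the compact `N₃ ∩ K`) satisfy `(T_{ij}(a^m)⁻¹ h)_{ij} = 0 ⟹ h_{ij} = a^m`, hence are pairwise disjoint (part 1 §1);
  **`borelRichardsonMeasure_apply_compl_orbit_nilpReg`** — `Λ_J((Ad·J)ᶜ) = 0`: for `u ∈ N₃`, `Y = u − 1` is strictly upper, `Y³ = 0`, `Y² = u₀₁u₁₂·E₁₃`, so
  `Ad(k)Y ∉ Ad·J ⟹ u₀₁u₁₂ = 0` (★ R1a `mem_orbit_nilpReg_iff`, `isNilpotent_conj`, `conj_mul_conj_eq_zero_iff`); `borelRichardsonMeasure_ne_zero`; `integral_borelRichardsonMeasure`.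
* §4 **`gl3_nilpotentStructure`** — ★ p857400 `gl3_nilpotentStructure_of_regularOrbitMeasure` (itself ★ (R1d) p857363 with `Λ_E` discharged) with `Λ_J` discharged:
  **every `T : C_c^∞(𝔤𝔩₃(F)) → ℂ` satisfying the four `J(𝒩)` clauses of (L-B_GL) at `N = 3` is `a·δ₀ + b·Λ_E + c·Λ_J`** — Harish-Chandra's Thm. 3.9 ∕ Cor. 3.10 for `𝔤𝔩₃`
  (`dim J(𝒩) = 3 =` number of nilpotent orbits), the STRUCTURE half (a) of (LBGL-ge3) at `N = 3`, HYPOTHESIS-FREE (Haar measures only).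
[HarishChandra1999AdmissibleDistributions, §3 pp. 8–10, Lemma 3.5, Thm. 3.9, Cor. 3.10]; [Howe1974, Prop. 2]; [Rogawski1990, §4.13 Lemma 4.13.1 (a)]; [BernsteinZelevinsky1976, §1.18].

HONEST LABEL: HC_CM is proved only modulo the 7 printed citations (2 remaining named inputs: hLiu418 = stmt-HodgeConjecture-24832, h413 = stmt-HodgeConjecture-24833)
until rung 0 closes; count-neutral helper.
-/

set_option autoImplicit false
set_option linter.dupNamespace false   -- `Summit.HodgeConjecture.HodgeConjecture.…` (D-0017 nested layout; lakefile exemption for Summits)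

noncomputable section

open MeasureTheory MeasureTheory.Measure Filter Topology Set TopologicalSpace ValuativeRel
open scoped MatrixGroups NNReal ENNReal Pointwise
open Literature.NumberTheory.Automorphic Literature.NumberTheory.Rogawski1990 Literature.MeasureTheory.Group
open Literature.NumberTheory.GaloisRepresentations Literature.NumberTheory.GaloisRepresentations.IsNonarchimedeanLocalField
open Summit.HodgeConjecture.HodgeConjecture.Cruxes.H413.K2E3GL3NilpotentOrbits
open Summit.HodgeConjecture.HodgeConjecture.Cruxes.H413.K2E3GL3BorelUnipotentMeasureConjInvariant
open Summit.HodgeConjecture.HodgeConjecture.Cruxes.H413.K2E3GL3BorelRichardsonMeasure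

namespace Summit.HodgeConjecture.HodgeConjecture.Cruxes.H413.K2E3GL3NilpotentStructure

/-! ## §3  `Λ_J` is carried by the regular orbit `Ad·J`, and `Λ_J ≠ 0` -/

section Support

variable (F : Type*) [Field F] [ValuativeRel F] [TopologicalSpace F] [IsNonarchimedeanLocalField F]
  [MeasurableSpace (GL (Fin 3) F)] [BorelSpace (GL (Fin 3) F)]

/-- **`{u ∈ N₃ | u_{ij} = 0}` IS `μ_N`-NULL** for `i < j` and every Haar measure `μ_N` on the upper unitriangular `N₃`: the left translates by the transvections
`T_{ij}(a^m)` (`0 < ‖a‖ < 1`, `a ∈ 𝒪`, all inside the compact `N₃ ∩ GL₃(𝒪)`) have `(T_{ij}(a^m) h)_{ij} = a^m`, so they are pairwise disjoint (§1).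
[cite: BernsteinZelevinsky1976, §1.18] -/
theorem haar_unipotentRadicalGL_setOf_apply_eq_zero (μN : Measure ↥(unipotentRadicalGL F (id : Fin 3 → Fin 3))) [IsHaarMeasure μN]
    {i j : Fin 3} (hij : i < j) :
    μN {u : ↥(unipotentRadicalGL F (id : Fin 3 → Fin 3)) | ((u : GL (Fin 3) F) : Matrix (Fin 3) (Fin 3) F) i j = 0} = 0 := by
  haveI : T2Space F := (isLocalField F).toT2Space
  haveI : LocallyCompactSpace F := (isLocalField F).toLocallyCompactSpace
  haveI : SecondCountableTopology F := secondCountableTopology_localField F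
  haveI : T2Space (GL (Fin 3) F) := t2Space_generalLinearGroup F 3
  haveI : LocallyCompactSpace (GL (Fin 3) F) := locallyCompactSpace_generalLinearGroup F 3
  haveI : SecondCountableTopology (Matrix (Fin 3) (Fin 3) F) := inferInstanceAs (SecondCountableTopology (Fin 3 → Fin 3 → F))
  haveI : SecondCountableTopology (Matrix (Fin 3) (Fin 3) F)ᵐᵒᵖ := MulOpposite.opHomeomorph.symm.secondCountableTopology
  haveI : SecondCountableTopology (GL (Fin 3) F) := Units.isEmbedding_embedProduct.secondCountableTopology
  haveI : BorelSpace ↥(unipotentRadicalGL F (id : Fin 3 → Fin 3)) := Subtype.borelSpace _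
  have hNcl := isClosed_unipotentRadicalGL (R := F) (id : Fin 3 → Fin 3)
  haveI : SigmaCompactSpace ↥(unipotentRadicalGL F (id : Fin 3 → Fin 3)) := hNcl.isClosedEmbedding_subtypeVal.sigmaCompactSpace
  -- a small non-zero integer `a`
  obtain ⟨ϖ, hϖ⟩ := IsDiscreteValuationRing.exists_irreducible 𝒪[F]
  set a : F := (ϖ : F) with ha
  have ha0 : a ≠ 0 := fun h => hϖ.ne_zero (Subtype.ext h)
  have haO : a ∈ 𝒪[F] := ϖ.2
  have ha1 : normAbs F a < 1 := normAbs_lt_one_iff_mem_maximalIdeal.2 hϖ.not_isUnit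
  -- the transvections `T x = 1 + x E_{ij}` as elements of `N₃`
  have hdet : ∀ x : F, (Matrix.transvection i j x).det ≠ 0 := fun x => by
    rw [Matrix.det_transvection_of_ne i j hij.ne x]; exact one_ne_zero
  set T : F → GL (Fin 3) F := fun x => Matrix.GeneralLinearGroup.mkOfDetNeZero (Matrix.transvection i j x) (hdet x) with hT
  have hTcoe : ∀ x, ((T x : GL (Fin 3) F) : Matrix (Fin 3) (Fin 3) F) = Matrix.transvection i j x := fun x => rfl
  have hTinv : ∀ x, (((T x)⁻¹ : GL (Fin 3) F) : Matrix (Fin 3) (Fin 3) F) = Matrix.transvection i j (-x) := fun x =>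
    Units.inv_eq_of_mul_eq_one_left (by rw [hTcoe, Matrix.transvection_mul_transvection_same i j hij.ne, neg_add_cancel, Matrix.transvection_zero])
  have hTN : ∀ x, T x ∈ unipotentRadicalGL F (id : Fin 3 → Fin 3) := fun x => mem_unipotentRadicalGL_id_of_eq_transvection hij x _ (hTcoe x)
  have hentry : ∀ x, x ∈ 𝒪[F] → ∀ p q : Fin 3, Matrix.transvection i j x p q ∈ 𝒪[F] := fun x hx p q => by
    rw [Matrix.transvection, Matrix.add_apply, Matrix.one_apply, Matrix.single_apply]
    refine add_mem ?_ ?_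
    · split_ifs
      · exact one_mem _
      · exact zero_mem _
    · split_ifs
      · exact hx
      · exact zero_mem _
  have hTK : ∀ m : ℕ, T (a ^ (m + 1)) ∈ glInt 3 F := fun m => by
    rw [mem_glInt_iff]
    refine ⟨fun p q => ?_, fun p q => ?_⟩
    · rw [hTcoe]; exact hentry _ (pow_mem haO _) p q
    · rw [hTinv]; exact hentry _ (neg_mem (pow_mem haO _)) p q
  set u : ℕ → ↥(unipotentRadicalGL F (id : Fin 3 → Fin 3)) := fun m => ⟨T (a ^ (m + 1)), hTN _⟩ with hu
  -- the compact `N₃ ∩ GL₃(𝒪)` contains every `u m`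
  have hK₀ : IsCompact ((Subtype.val : ↥(unipotentRadicalGL F (id : Fin 3 → Fin 3)) → GL (Fin 3) F) ⁻¹' (glInt 3 F : Set (GL (Fin 3) F))) :=
    hNcl.isClosedEmbedding_subtypeVal.isCompact_preimage (isCompact_glInt (n := 3) (F := F))
  have huK : ∀ m, u m ∈ (Subtype.val : ↥(unipotentRadicalGL F (id : Fin 3 → Fin 3)) → GL (Fin 3) F) ⁻¹' (glInt 3 F : Set (GL (Fin 3) F)) := fun m => hTK m
  -- translates: the `(i,j)` entry of `u_m⁻¹ h` for `h` in the `m`-th translate is pinned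
  have hmeas : MeasurableSet {u : ↥(unipotentRadicalGL F (id : Fin 3 → Fin 3)) | ((u : GL (Fin 3) F) : Matrix (Fin 3) (Fin 3) F) i j = 0} :=
    (isClosed_eq ((Units.continuous_val.comp continuous_subtype_val).matrix_elem i j) continuous_const).measurableSet
  have hkey : ∀ (m : ℕ) (h : ↥(unipotentRadicalGL F (id : Fin 3 → Fin 3))),
      h ∈ (fun h' => (u m)⁻¹ * h') ⁻¹' {u : ↥(unipotentRadicalGL F (id : Fin 3 → Fin 3)) | ((u : GL (Fin 3) F) : Matrix (Fin 3) (Fin 3) F) i j = 0} →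
        ((h : GL (Fin 3) F) : Matrix (Fin 3) (Fin 3) F) i j = a ^ (m + 1) := fun m h hh => by
    have hh' : ((((u m)⁻¹ * h : ↥(unipotentRadicalGL F (id : Fin 3 → Fin 3))) : GL (Fin 3) F) : Matrix (Fin 3) (Fin 3) F) i j = 0 := hh
    rw [Subgroup.coe_mul, Subgroup.coe_inv, Units.val_mul, hu] at hh'
    simp only at hh'
    rw [hTinv, Matrix.transvection_mul_apply_same] at hh'
    -- `h_{jj} = 1` for `h ∈ N₃`
    obtain ⟨-, hdiag⟩ := (mem_unipotentRadicalGL_iff_entry (id : Fin 3 → Fin 3) (h : GL (Fin 3) F)).1 h.2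
    rw [hdiag j j rfl, Matrix.one_apply_eq, mul_one] at hh'
    linear_combination hh'
  have hinj : ∀ {m m' : ℕ}, a ^ (m + 1) = a ^ (m' + 1) → m = m' := fun {m m'} h => by
    have h2 := congrArg (normAbs F) h
    rw [map_pow, map_pow] at h2
    exact Nat.succ_injective ((pow_right_strictAnti₀ ((map_ne_zero (normAbs F)).2 ha0 |>.bot_lt) ha1).injective h2)
  have hdisj : Pairwise fun m m' => Disjoint
      ((fun h' => (u m)⁻¹ * h') ⁻¹' {u : ↥(unipotentRadicalGL F (id : Fin 3 → Fin 3)) | ((u : GL (Fin 3) F) : Matrix (Fin 3) (Fin 3) F) i j = 0})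
      ((fun h' => (u m')⁻¹ * h') ⁻¹' {u : ↥(unipotentRadicalGL F (id : Fin 3 → Fin 3)) | ((u : GL (Fin 3) F) : Matrix (Fin 3) (Fin 3) F) i j = 0}) :=
    fun m m' hmm' => Set.disjoint_left.2 fun h h1 h2 => hmm' (hinj ((hkey m h h1).symm.trans (hkey m' h h2)))
  exact measure_eq_zero_of_pairwise_disjoint_translates μN hmeas u hdisj hK₀ huK

variable [MeasurableSpace (Matrix (Fin 3) (Fin 3) F)] [BorelSpace (Matrix (Fin 3) (Fin 3) F)]
  (κ : Measure ↥(glInt 3 F)) (μN : Measure ↥(unipotentRadicalGL F (id : Fin 3 → Fin 3)))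

/-- **`Λ_J` IS CARRIED BY THE REGULAR ORBIT**: `Λ_J((Ad·J)ᶜ) = 0`.  `Ad(k)(u − 1) ∉ Ad·J` forces `(u − 1)² = 0`, i.e. `u₀₁ u₁₂ = 0` (★ R1a
`mem_orbit_nilpReg_iff`), a `μ_N`-null event. [cite: HarishChandra1999AdmissibleDistributions, §3 p. 9, Lemma 3.5] -/
theorem borelRichardsonMeasure_apply_compl_orbit_nilpReg [SFinite μN] [IsHaarMeasure μN] :
    ((κ.prod μN).map fun q : ↥(glInt 3 F) × ↥(unipotentRadicalGL F (id : Fin 3 → Fin 3)) =>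
      ((q.1 : GL (Fin 3) F) : Matrix (Fin 3) (Fin 3) F) * (((q.2 : GL (Fin 3) F) : Matrix (Fin 3) (Fin 3) F) - 1) *
        (((q.1 : GL (Fin 3) F)⁻¹ : GL (Fin 3) F) : Matrix (Fin 3) (Fin 3) F))
      (MulAction.orbit (ConjAct (GL (Fin 3) F)) (!![0, 1, 0; 0, 0, 1; 0, 0, 0] : Matrix (Fin 3) (Fin 3) F))ᶜ = 0 := by
  haveI : T2Space F := (isLocalField F).toT2Space
  rw [Measure.map_apply (measurable_borelRichardsonMap F) (K2E3GL3NilpotentOrbitSpaces.measurableSet_orbit_nilpReg).compl]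
  refine measure_mono_null (fun q hq => ?_) ?_ (t := Set.univ ×ˢ ({u : ↥(unipotentRadicalGL F (id : Fin 3 → Fin 3)) |
      ((u : GL (Fin 3) F) : Matrix (Fin 3) (Fin 3) F) 0 1 = 0} ∪ {u | ((u : GL (Fin 3) F) : Matrix (Fin 3) (Fin 3) F) 1 2 = 0}))
  · refine Set.mk_mem_prod (Set.mem_univ _) ?_
    by_contra hu
    simp only [Set.mem_union, Set.mem_setOf_eq, not_or] at hu
    apply hq
    -- `Y = u − 1` is in `Ad·J`, hence so is `Ad(k) Y`
    obtain ⟨hsq, hcube⟩ := strictUpper_sq_and_cube F (((q.2 : GL (Fin 3) F) : Matrix (Fin 3) (Fin 3) F) 0 1)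
      (((q.2 : GL (Fin 3) F) : Matrix (Fin 3) (Fin 3) F) 0 2) (((q.2 : GL (Fin 3) F) : Matrix (Fin 3) (Fin 3) F) 1 2)
    have hY2 : ((((q.2 : GL (Fin 3) F)) : Matrix (Fin 3) (Fin 3) F) - 1) * ((((q.2 : GL (Fin 3) F)) : Matrix (Fin 3) (Fin 3) F) - 1) ≠ 0 := by
      rw [coe_sub_one_eq, hsq]
      intro h0
      have h02 := congrFun (congrFun h0 0) 2
      simp only [Matrix.of_apply, Matrix.cons_val', Matrix.cons_val_zero, Matrix.cons_val_two, Matrix.tail_cons, Matrix.head_cons, Matrix.zero_apply,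
        mul_eq_zero] at h02
      rcases h02 with h | h
      · exact hu.1 h
      · exact hu.2 h
    have hY3 : ((((q.2 : GL (Fin 3) F)) : Matrix (Fin 3) (Fin 3) F) - 1) ^ 3 = 0 := by rw [coe_sub_one_eq, hcube]
    refine (mem_orbit_nilpReg_iff _).2 ⟨pow_three_eq_zero_of_isNilpotent (isNilpotent_conj _ ⟨3, hY3⟩), ?_⟩
    rwa [Ne, conj_mul_conj_eq_zero_iff]
  · rw [Measure.prod_prod]
    refine mul_eq_zero_of_right _ (measure_union_null ?_ ?_)
    · exact haar_unipotentRadicalGL_setOf_apply_eq_zero F μN (show (0 : Fin 3) < 1 by decide)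
    · exact haar_unipotentRadicalGL_setOf_apply_eq_zero F μN (show (1 : Fin 3) < 2 by decide)

/-- **`Λ_J ≠ 0`** (`Λ_J(𝔤𝔩₃) = κ(K) μ_N(N₃) > 0`). [cite: HarishChandra1999AdmissibleDistributions, §3 p. 9] -/
theorem borelRichardsonMeasure_ne_zero [IsHaarMeasure κ] [IsHaarMeasure μN] [SFinite μN] :
    ((κ.prod μN).map fun q : ↥(glInt 3 F) × ↥(unipotentRadicalGL F (id : Fin 3 → Fin 3)) =>
      ((q.1 : GL (Fin 3) F) : Matrix (Fin 3) (Fin 3) F) * (((q.2 : GL (Fin 3) F) : Matrix (Fin 3) (Fin 3) F) - 1) *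
        (((q.1 : GL (Fin 3) F)⁻¹ : GL (Fin 3) F) : Matrix (Fin 3) (Fin 3) F)) ≠ 0 := by
  intro h
  have h1 := congrArg (fun m : Measure (Matrix (Fin 3) (Fin 3) F) => m Set.univ) h
  simp only [Measure.map_apply (measurable_borelRichardsonMap F) MeasurableSet.univ, Set.preimage_univ, Measure.coe_zero, Pi.zero_apply] at h1
  rw [← Set.univ_prod_univ, Measure.prod_prod] at h1
  exact mul_ne_zero (isOpen_univ.measure_pos κ ⟨1, Set.mem_univ _⟩).ne' (isOpen_univ.measure_pos μN ⟨1, Set.mem_univ _⟩).ne' h1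

/-- **Integration against `Λ_J`**: `∫ f dΛ_J = ∫_{K×N₃} f(Ad(k)(u − 1)) d(κ ⊗ μ_N)` for continuous `f` — the regular nilpotent orbital integral in Rao's `K × N` form.
[cite: HarishChandra1999AdmissibleDistributions, §3 p. 9] -/
theorem integral_borelRichardsonMeasure {E : Type*} [NormedAddCommGroup E] [NormedSpace ℝ E] {f : Matrix (Fin 3) (Fin 3) F → E} (hf : Continuous f) :
    ∫ X, f X ∂((κ.prod μN).map fun q : ↥(glInt 3 F) × ↥(unipotentRadicalGL F (id : Fin 3 → Fin 3)) =>
      ((q.1 : GL (Fin 3) F) : Matrix (Fin 3) (Fin 3) F) * (((q.2 : GL (Fin 3) F) : Matrix (Fin 3) (Fin 3) F) - 1) *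
        (((q.1 : GL (Fin 3) F)⁻¹ : GL (Fin 3) F) : Matrix (Fin 3) (Fin 3) F)) =
      ∫ q : ↥(glInt 3 F) × ↥(unipotentRadicalGL F (id : Fin 3 → Fin 3)), f (((q.1 : GL (Fin 3) F) : Matrix (Fin 3) (Fin 3) F) *
        (((q.2 : GL (Fin 3) F) : Matrix (Fin 3) (Fin 3) F) - 1) * (((q.1 : GL (Fin 3) F)⁻¹ : GL (Fin 3) F) : Matrix (Fin 3) (Fin 3) F)) ∂(κ.prod μN) := by
  haveI : T2Space F := (isLocalField F).toT2Space
  haveI : SecondCountableTopology F := secondCountableTopology_localField F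
  haveI : SecondCountableTopology (Matrix (Fin 3) (Fin 3) F) := inferInstanceAs (SecondCountableTopology (Fin 3 → Fin 3 → F))
  exact integral_map (measurable_borelRichardsonMap F).aemeasurable hf.aestronglyMeasurable

end Support

/-! ## §4  `J(𝒩)(𝔤𝔩₃(F)) = ℂδ₀ ⊕ ℂΛ_E ⊕ ℂΛ_J`, both Richardson measures explicit -/

section Structure

variable {F : Type*} [Field F] [ValuativeRel F] [TopologicalSpace F] [IsNonarchimedeanLocalField F]
  [MeasurableSpace (GL (Fin 3) F)] [BorelSpace (GL (Fin 3) F)] [MeasurableSpace (Matrix (Fin 3) (Fin 3) F)] [BorelSpace (Matrix (Fin 3) (Fin 3) F)]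

/-- **THE STRUCTURE OF `J(𝒩)(𝔤𝔩₃(F))`, HYPOTHESIS-FREE.**  `F` non-archimedean local, `κ` a Haar measure on `K = GL₃(𝒪)`, `μ_U` on the unipotent radical `U` of the
standard parabolic of type `(2,1)`, `μ_N` on the upper unitriangular `N₃`; `Λ_E = (Ad(k)(u − 1))_*(κ ⊗ μ_U)`, `Λ_J = (Ad(k)(u − 1))_*(κ ⊗ μ_N)` the Richardson measures
of the minimal and the regular nilpotent orbit.  Then EVERY `T : C_c^∞(𝔤𝔩₃(F)) → ℂ` which is additive, homogeneous, `Ad(GL₃(F))`-invariant and zero on test functions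
whose support meets no nilpotent (the four `J(𝒩)` clauses of (L-B_GL) ∕ (LBGL-ge3) at `N = 3`) satisfies
`T f = a·f(0) + b·∫ f(Ad(k)(u−1)) d(κ⊗μ_U) + c·∫ f(Ad(k)(u−1)) d(κ⊗μ_N)` for all `f ∈ C_c^∞`: `dim J(𝒩)(𝔤𝔩₃) = 3 =` number of nilpotent orbits.
(★ (R1d) p857363 ∘ ★ p857400 (`Λ_E`, K2E3-p21 (g4)) ∘ §2–§3 (`Λ_J`).)
[cite: HarishChandra1999AdmissibleDistributions, §3 Thm. 3.9, Cor. 3.10 p. 10] [cite: Howe1974, Prop. 2] [cite: BernsteinZelevinsky1976, §1.18] -/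
theorem gl3_nilpotentStructure [MeasurableSpace F] [BorelSpace F]
    (κ : Measure ↥(glInt 3 F)) [IsHaarMeasure κ] (μU : Measure ↥(unipotentRadicalGL F ![false, false, true])) [IsHaarMeasure μU]
    (μN : Measure ↥(unipotentRadicalGL F (id : Fin 3 → Fin 3))) [IsHaarMeasure μN]
    (T : (Matrix (Fin 3) (Fin 3) F → ℂ) → ℂ)
    (hT : (∀ f₁ f₂ : Matrix (Fin 3) (Fin 3) F → ℂ, IsLocSmooth f₁ → IsLocSmooth f₂ → T (f₁ + f₂) = T f₁ + T f₂) ∧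
       (∀ (a : ℂ) (f : Matrix (Fin 3) (Fin 3) F → ℂ), IsLocSmooth f → T (a • f) = a * T f) ∧
       (∀ (x : GL (Fin 3) F) (f : Matrix (Fin 3) (Fin 3) F → ℂ), IsLocSmooth f →
          T (fun X => f ((x : Matrix (Fin 3) (Fin 3) F) * X * ((x⁻¹ : GL (Fin 3) F) : Matrix (Fin 3) (Fin 3) F))) = T f) ∧
       (∀ f : Matrix (Fin 3) (Fin 3) F → ℂ, IsLocSmooth f → (∀ X ∈ tsupport f, ¬ IsNilpotent X) → T f = 0)) :
    ∃ a b c : ℂ, ∀ f : Matrix (Fin 3) (Fin 3) F → ℂ, IsLocSmooth f →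
      T f = a * f 0 +
        b * ∫ q : ↥(glInt 3 F) × ↥(unipotentRadicalGL F ![false, false, true]), f ((((q.1 : GL (Fin 3) F)) : Matrix (Fin 3) (Fin 3) F) *
          ((((q.2 : GL (Fin 3) F)) : Matrix (Fin 3) (Fin 3) F) - 1) * ((((q.1 : GL (Fin 3) F))⁻¹ : GL (Fin 3) F) : Matrix (Fin 3) (Fin 3) F)) ∂(κ.prod μU) +
        c * ∫ q : ↥(glInt 3 F) × ↥(unipotentRadicalGL F (id : Fin 3 → Fin 3)), f (((q.1 : GL (Fin 3) F) : Matrix (Fin 3) (Fin 3) F) *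
          (((q.2 : GL (Fin 3) F) : Matrix (Fin 3) (Fin 3) F) - 1) * (((q.1 : GL (Fin 3) F)⁻¹ : GL (Fin 3) F) : Matrix (Fin 3) (Fin 3) F)) ∂(κ.prod μN) := by
  haveI : T2Space F := (isLocalField F).toT2Space
  haveI : LocallyCompactSpace F := (isLocalField F).toLocallyCompactSpace
  haveI : SecondCountableTopology F := secondCountableTopology_localField F
  haveI : T2Space (GL (Fin 3) F) := t2Space_generalLinearGroup F 3
  haveI : LocallyCompactSpace (GL (Fin 3) F) := locallyCompactSpace_generalLinearGroup F 3
  haveI : SecondCountableTopology (Matrix (Fin 3) (Fin 3) F) := inferInstanceAs (SecondCountableTopology (Fin 3 → Fin 3 → F))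
  haveI : SecondCountableTopology (Matrix (Fin 3) (Fin 3) F)ᵐᵒᵖ := MulOpposite.opHomeomorph.symm.secondCountableTopology
  haveI : SecondCountableTopology (GL (Fin 3) F) := Units.isEmbedding_embedProduct.secondCountableTopology
  haveI : SecondCountableTopology ↥(unipotentRadicalGL F (id : Fin 3 → Fin 3)) := TopologicalSpace.Subtype.secondCountableTopology _
  haveI : BorelSpace ↥(unipotentRadicalGL F (id : Fin 3 → Fin 3)) := Subtype.borelSpace _
  haveI : LocallyCompactSpace ↥(unipotentRadicalGL F (id : Fin 3 → Fin 3)) := (isClosed_unipotentRadicalGL (R := F) (id : Fin 3 → Fin 3)).locallyCompactSpace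
  haveI : SFinite μN := inferInstance
  haveI : CompactSpace ↥(glInt 3 F) := isCompact_iff_compactSpace.1 (isCompact_glInt (n := 3) (F := F))
  haveI : IsFiniteMeasure κ := CompactSpace.isFiniteMeasure
  haveI := isFiniteMeasureOnCompacts_borelRichardsonMeasure F κ μN
  obtain ⟨a, b, c, h⟩ := K2E3GL3MinimalRichardsonMeasure.gl3_nilpotentStructure_of_regularOrbitMeasure (F := F) (c := ![false, false, true]) κ μU
    (by decide) ⟨0, 2, rfl, rfl⟩ _ (GL3.map_Ad_borelRichardsonMeasure_eq F κ μN) (borelRichardsonMeasure_apply_compl_orbit_nilpReg F κ μN)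
    (borelRichardsonMeasure_ne_zero F κ μN) T hT
  refine ⟨a, b, c, fun f hf => ?_⟩
  rw [h f hf, integral_borelRichardsonMeasure F κ μN hf.continuous]

end Structure

end Summit.HodgeConjecture.HodgeConjecture.Cruxes.H413.K2E3GL3NilpotentStructure

end
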